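import Summits.QuantumFields.QCD.Theorems.SpectralDefectExtinctionWegnerEstimateCoareaCircleMajorant
import Summits.QuantumFields.QCD.Theorems.SpectralDefectExtinctionWegnerEstimateCoareaTubeSum

/-!
# Bridge lemma N₂ toward stub `coareaWegner` of line `Sketch` (skeleton "ResolventCell", gen 2) for
crux `SpectralDefectExtinction.WegnerEstimate` (item stmt-QuantumFields-8966):
the ABSTRACT CORE of the 1-D route — pointwise rigidity bound + circle majorants + slice + tube sum

All the measure theory of the paper proof (Lines/Sketch.md §gen 2) in an abstract setting: a compact
second-countable group `G`, configurations `V : ι → G` under product Haar `μ`, a continuous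
Hermitian-valued `H`, a non-negative continuous observable `t(V)`, a continuous badness `b ≥ 0` with
small saturated tubes, and finitely many directions `d`, each a one-link circle `(e_d, c_d)` carrying a
current `J_d` (the `s`-derivative of the quadratic form of `H` along the circle) whose sorted
eigenvalues are Lipschitz along circles and obey a uniform AREA BOUND `Σ_i ∫ |Λ_i'| φ(Λ_i) ≤ B`.
IF pointwise `t(V) ≤ A₀ + (c₀ b(V)^k)⁻¹ Σ_d Σ_j [|λ_j| ≤ 1] |J_d(V, u_j)| φ(λ_j)` (Mathlib's eigenpairs;
the output of bridge G) whenever `b(V) > 0`, THEN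

  `∫⁻ t dμ ≤ A₀ + c₀⁻¹ · #directions · (2π)⁻¹ · B · (1 + C_B k/(m − k))`

(`coareaWegner_core_lintegral_le`).  Ingredients: the canonical measurable majorant and its a.e.
identification with the current sums (bridge N₁), the fibre-minimised badness `m_d(V) = min_g b(V[e_d ↦ g])`
(continuous, constant on `e_d`-fibres, with the same small balls, positive a.e.), the slice inequality
(bridge F) and the tube sum (bridge E).
-/

noncomputable section

namespace Summit.QuantumFields.QCD.Cruxes.WegnerEstimate.ResolventCell

open MeasureTheory Filter
open scoped Matrix BigOperators ENNReal NNReal Topology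
open Literature.MathematicalPhysics.QuantumLattice Literature.MathematicalPhysics.QuantumFieldTheory
  Literature.Probability.LatticeModels
open Matrix
open scoped ComplexOrder

section Core

variable {G : Type*} [Group G] [TopologicalSpace G] [IsTopologicalGroup G] [CompactSpace G]
  [MeasurableSpace G] [BorelSpace G] [SecondCountableTopology G]
  {ι : Type*} [Fintype ι] [DecidableEq ι]

/-! ### The fibre-minimised badness -/

omit [IsTopologicalGroup G] [MeasurableSpace G] [BorelSpace G] [SecondCountableTopology G] [Fintype ι] in
/-- **Fibre minimisation of a continuous function over one link.**  For continuous `b` on `ι → G` and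
a link `e`, `m(V) = inf_g b(V[e ↦ g])` is continuous, `≤ b`, constant on `e`-fibres, and
`{m < δ} = {V | ∃ g, b(V[e ↦ g]) < δ}`. -/
theorem coareaWegner_fibreMin (b : (ι → G) → ℝ) (hb : Continuous b) (e : ι) :
    (Continuous fun V : ι → G => sInf ((fun g : G => b (Function.update V e g)) '' Set.univ)) ∧
    (∀ V : ι → G, sInf ((fun g : G => b (Function.update V e g)) '' Set.univ) ≤ b V) ∧
    (∀ (V : ι → G) (g' : G), sInf ((fun g : G => b (Function.update (Function.update V e g') e g)) '' Set.univ) =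
      sInf ((fun g : G => b (Function.update V e g)) '' Set.univ)) ∧
    (∀ (V : ι → G) (δ : ℝ), sInf ((fun g : G => b (Function.update V e g)) '' Set.univ) < δ ↔
      ∃ g : G, b (Function.update V e g) < δ) ∧
    (∀ V : ι → G, (∀ W, 0 ≤ b W) → 0 ≤ sInf ((fun g : G => b (Function.update V e g)) '' Set.univ)) := by
  have hne : ∀ V : ι → G, ((fun g : G => b (Function.update V e g)) '' Set.univ).Nonempty := fun V =>
    ⟨_, ⟨1, Set.mem_univ _, rfl⟩⟩
  have hcpt : ∀ V : ι → G, IsCompact ((fun g : G => b (Function.update V e g)) '' Set.univ) := fun V =>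
    isCompact_univ.image (hb.comp (continuous_const.update e continuous_id))
  have hmem : ∀ V : ι → G, sInf ((fun g : G => b (Function.update V e g)) '' Set.univ) ∈
      (fun g : G => b (Function.update V e g)) '' Set.univ := fun V => (hcpt V).sInf_mem (hne V)
  refine ⟨?_, ?_, ?_, ?_, ?_⟩
  · have hj : Continuous (Function.uncurry fun (V : ι → G) (g : G) => b (Function.update V e g)) := by
      rw [Function.uncurry_def]
      exact hb.comp (continuous_fst.update e continuous_snd)
    exact isCompact_univ.continuous_sInf hj
  · intro V
    refine csInf_le (hcpt V).bddBelow ⟨V e, Set.mem_univ _, ?_⟩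
    simp
  · intro V g'
    simp only [Function.update_idem]
  · intro V δ
    constructor
    · intro h
      obtain ⟨g, -, hg⟩ := hmem V
      refine ⟨g, ?_⟩
      have hg' : b (Function.update V e g) = sInf ((fun g : G => b (Function.update V e g)) '' Set.univ) := hg
      rw [hg']
      exact h
    · rintro ⟨g, hg⟩
      exact lt_of_le_of_lt (csInf_le (hcpt V).bddBelow ⟨g, Set.mem_univ _, rfl⟩) hg
  · intro V hb0
    obtain ⟨g, -, hg⟩ := hmem V
    have hg' : b (Function.update V e g) = sInf ((fun g : G => b (Function.update V e g)) '' Set.univ) := hg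
    rw [← hg']
    exact hb0 _

/-- A set whose measure is below `C δ^m` for every `δ ∈ (0,1]` (`m > 0`) is null. -/
theorem coareaWegner_measure_zero_of_forall_small {α : Type*} [MeasurableSpace α] (μ : Measure α)
    (S : Set α) {C m : ℝ} (hm : 0 < m)
    (h : ∀ δ : ℝ, 0 < δ → δ ≤ 1 → μ S ≤ ENNReal.ofReal (C * δ ^ m)) : μ S = 0 := by
  have hlim : Tendsto (fun N : ℕ => ENNReal.ofReal (C * ((1 : ℝ) / ((N : ℝ) + 1)) ^ m)) atTop (𝓝 0) := by
    have h1 : Tendsto (fun N : ℕ => (1 : ℝ) / ((N : ℝ) + 1)) atTop (𝓝 0) :=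
      tendsto_one_div_add_atTop_nhds_zero_nat
    have h2 : Tendsto (fun N : ℕ => ((1 : ℝ) / ((N : ℝ) + 1)) ^ m) atTop (𝓝 0) := by
      have := h1.rpow_const (p := m) (Or.inr hm.le)
      rwa [Real.zero_rpow hm.ne'] at this
    have h3 : Tendsto (fun N : ℕ => C * ((1 : ℝ) / ((N : ℝ) + 1)) ^ m) atTop (𝓝 0) := by
      have := h2.const_mul C
      rwa [mul_zero] at this
    have h4 := ENNReal.tendsto_ofReal h3
    rwa [ENNReal.ofReal_zero] at h4
  refine le_antisymm (ge_of_tendsto' hlim (fun N => h _ (by positivity) ?_)) zero_le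
  rw [div_le_one (by positivity)]
  linarith [(Nat.cast_nonneg N : (0 : ℝ) ≤ N)]

variable {n : Type*} [Fintype n] [DecidableEq n]

/-- **The abstract core of the 1-D route.**  See the module docstring. -/
theorem coareaWegner_core_lintegral_le
    (Hof : (ι → G) → Matrix n n ℂ) (hHof : Continuous Hof) (hHerm : ∀ V, (Hof V).IsHermitian)
    (tx : (ι → G) → ℝ)
    (b : (ι → G) → ℝ) (hbc : Continuous b) (hb0 : ∀ V, 0 ≤ b V)
    (φ : ℝ → ℝ) (hφ : Continuous φ) (hφ0 : ∀ E, 0 ≤ φ E)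
    {A₀ c₀ C_B m : ℝ} {k : ℕ} (hA₀ : 0 ≤ A₀) (hc₀ : 0 < c₀) (hCB : 0 < C_B) (hkm : (k : ℝ) < m)
    (e₀ : ι)
    (hsmall : ∀ (e' : ι) (δ : ℝ), 0 < δ → δ ≤ 1 →
      (Measure.pi fun _ : ι => haarProbability G) {V : ι → G | ∃ g : G, b (Function.update V e' g) < δ} ≤
        ENNReal.ofReal (C_B * δ ^ m))
    {Dir : Type*} [Fintype Dir] (e : Dir → ι) (c : Dir → ℝ → G) (hc0 : ∀ d, c d 0 = 1)
    (hmul : ∀ d s t, c d (s + t) = c d s * c d t) (hcont : ∀ d, Continuous (c d))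
    (J : Dir → (ι → G) → (n → ℂ) → ℝ)
    (hJ : ∀ d (V : ι → G) (ψ : n → ℂ),
      HasDerivAt (fun s => (star ψ ⬝ᵥ (Hof (Function.update V (e d) (V (e d) * c d s))).mulVec ψ).re)
        (J d V ψ) 0)
    (hlip : ∀ d (V : ι → G), ∃ K : ℝ≥0, ∀ i : Fin (Fintype.card n),
      LipschitzWith K fun s => (hHerm (Function.update V (e d) (V (e d) * c d s))).eigenvalues₀ i)
    (hdiffH : ∀ d (V : ι → G), ∃ Hd : Matrix n n ℂ, ∀ p q,
      HasDerivAt (fun s => Hof (Function.update V (e d) (V (e d) * c d s)) p q) (Hd p q) 0)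
    {B : ℝ≥0∞}
    (harea : ∀ d (V : ι → G), ∑ i : Fin (Fintype.card n), ∫⁻ t in Set.Icc 0 (2 * Real.pi),
      ENNReal.ofReal (|deriv (fun s => (hHerm (Function.update V (e d) (V (e d) * c d s))).eigenvalues₀ i) t| *
        φ ((hHerm (Function.update V (e d) (V (e d) * c d t))).eigenvalues₀ i)) ≤ B)
    (hpt : ∀ V : ι → G, 0 < b V → tx V ≤ A₀ + (c₀ * b V ^ k)⁻¹ *
      ∑ d, ∑ j : n, (if |(hHerm V).eigenvalues j| ≤ 1 then
        |J d V ⇑((hHerm V).eigenvectorBasis j)| * φ ((hHerm V).eigenvalues j) else 0)) :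
    ∫⁻ V, ENNReal.ofReal (tx V) ∂(Measure.pi fun _ : ι => haarProbability G) ≤
      ENNReal.ofReal A₀ + ENNReal.ofReal c₀⁻¹ * (Fintype.card Dir *
        (ENNReal.ofReal (2 * Real.pi)⁻¹ * B * ENNReal.ofReal (1 + C_B * (k / (m - k))))) := by
  set μ : Measure (ι → G) := Measure.pi fun _ : ι => haarProbability G with hμ
  have hm0 : 0 < m := lt_of_le_of_lt (Nat.cast_nonneg k) hkm
  -- the fibre-minimised badness of each direction
  set md : Dir → (ι → G) → ℝ := fun d V =>
    sInf ((fun g : G => b (Function.update V (e d) g)) '' Set.univ) with hmd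
  have hmd_cont : ∀ d, Continuous (md d) := fun d => (coareaWegner_fibreMin b hbc (e d)).1
  have hmd_le : ∀ d V, md d V ≤ b V := fun d V => (coareaWegner_fibreMin b hbc (e d)).2.1 V
  have hmd_fib : ∀ d V (g' : G), md d (Function.update V (e d) g') = md d V := fun d V g' =>
    (coareaWegner_fibreMin b hbc (e d)).2.2.1 V g'
  have hmd_lt : ∀ d V (δ : ℝ), md d V < δ ↔ ∃ g : G, b (Function.update V (e d) g) < δ := fun d V δ =>
    (coareaWegner_fibreMin b hbc (e d)).2.2.2.1 V δ
  have hmd0 : ∀ d V, 0 ≤ md d V := fun d V => (coareaWegner_fibreMin b hbc (e d)).2.2.2.2 V hb0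
  have hmd_small : ∀ d (δ : ℝ), 0 < δ → δ ≤ 1 →
      μ {V | md d V < δ} ≤ ENNReal.ofReal (C_B * δ ^ m) := by
    intro d δ hδ hδ1
    have : {V | md d V < δ} = {V : ι → G | ∃ g : G, b (Function.update V (e d) g) < δ} :=
      Set.ext fun V => hmd_lt d V δ
    rw [this]
    exact hsmall (e d) δ hδ hδ1
  -- the badness and its fibre minima are positive a.e.
  have hb_small : ∀ (δ : ℝ), 0 < δ → δ ≤ 1 → μ {V | b V < δ} ≤ ENNReal.ofReal (C_B * δ ^ m) := by
    intro δ hδ hδ1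
    refine le_trans (measure_mono fun V hV => ?_) (hsmall e₀ δ hδ hδ1)
    exact ⟨V e₀, by simpa using hV⟩
  have hae_pos : ∀ᵐ V ∂μ, 0 < b V ∧ ∀ d, 0 < md d V := by
    have h1 : ∀ᵐ V ∂μ, 0 < b V := by
      rw [ae_iff]
      refine coareaWegner_measure_zero_of_forall_small μ _ hm0 fun δ hδ hδ1 =>
        le_trans (measure_mono fun V hV => ?_) (hb_small δ hδ hδ1)
      simp only [Set.mem_setOf_eq, not_lt] at hV ⊢
      exact lt_of_le_of_lt hV hδ
    have h2 : ∀ d, ∀ᵐ V ∂μ, 0 < md d V := by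
      intro d
      rw [ae_iff]
      refine coareaWegner_measure_zero_of_forall_small μ _ hm0 fun δ hδ hδ1 =>
        le_trans (measure_mono fun V hV => ?_) (hmd_small d δ hδ hδ1)
      simp only [Set.mem_setOf_eq, not_lt] at hV ⊢
      exact lt_of_le_of_lt hV hδ
    filter_upwards [h1, ae_all_iff.2 h2] with V hV1 hV2
    exact ⟨hV1, hV2⟩
  -- the canonical majorants
  set Rd : Dir → (ι → G) → ℝ := fun d V => ∑ i : Fin (Fintype.card n),
    |deriv (fun s => (hHerm (Function.update V (e d) (V (e d) * c d s))).eigenvalues₀ i) 0| *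
      φ ((hHerm V).eigenvalues₀ i) with hRd
  have hRd0 : ∀ d V, 0 ≤ Rd d V := fun d V =>
    Finset.sum_nonneg fun i _ => mul_nonneg (abs_nonneg _) (hφ0 _)
  have hRd_meas : ∀ d, Measurable fun V => ENNReal.ofReal (Rd d V) := fun d =>
    coareaWegner_majorant_measurable (e d) Hof hHerm (hcont d) hHof φ hφ
  have hRd_ae : ∀ d, ∀ᵐ V ∂μ,
      ∑ j : n, |J d V ⇑((hHerm V).eigenvectorBasis j)| * φ ((hHerm V).eigenvalues j) = Rd d V := fun d =>
    coareaWegner_majorant_ae_dominates (e d) Hof hHerm (hc0 d) (hmul d) (hcont d) hHof (hlip d) (hdiffH d)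
      (J d) (hJ d) φ
  -- the weights
  set Md : Dir → (ι → G) → ℝ≥0∞ := fun d V => ENNReal.ofReal (md d V ^ (-(k : ℝ))) with hMd
  have hMd_meas : ∀ d, Measurable (Md d) := fun d =>
    ENNReal.measurable_ofReal.comp (((hmd_cont d).measurable).pow_const _)
  have hMd_fib : ∀ d V (g : G), Md d (Function.update V (e d) (V (e d) * g)) = Md d V := by
    intro d V g
    simp only [hMd, hmd_fib]
  have hMd_int : ∀ d, ∫⁻ V, Md d V ∂μ ≤ ENNReal.ofReal (1 + C_B * (k / (m - k))) := by
    intro d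
    rcases Nat.eq_zero_or_pos k with hk0 | hkpos
    · subst hk0
      simp only [hMd, Nat.cast_zero, neg_zero, Real.rpow_zero, ENNReal.ofReal_one, lintegral_const,
        measure_univ, mul_one, zero_div, mul_zero, add_zero]
      exact le_rfl
    · exact coareaWegner_lintegral_rpow_neg_le μ (hmd_cont d).measurable (hmd0 d) hCB.le
        (Nat.cast_pos.2 hkpos) hkm (hmd_small d)
  -- the a.e. pointwise bound in measurable terms
  have hptae : ∀ᵐ V ∂μ, ENNReal.ofReal (tx V) ≤
      ENNReal.ofReal A₀ + ENNReal.ofReal c₀⁻¹ * ∑ d, Md d V * ENNReal.ofReal (Rd d V) := by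
    filter_upwards [hae_pos, ae_all_iff.2 hRd_ae] with V hVpos hVR
    obtain ⟨hbV, hmdV⟩ := hVpos
    -- real-number form
    have hcut : ∀ d, ∑ j : n, (if |(hHerm V).eigenvalues j| ≤ 1 then
        |J d V ⇑((hHerm V).eigenvectorBasis j)| * φ ((hHerm V).eigenvalues j) else 0) ≤ Rd d V := by
      intro d
      rw [← hVR d]
      refine Finset.sum_le_sum fun j _ => ?_
      split_ifs
      · exact le_rfl
      · exact mul_nonneg (abs_nonneg _) (hφ0 _)
    have hw : ∀ d, (c₀ * b V ^ k)⁻¹ ≤ c₀⁻¹ * md d V ^ (-(k : ℝ)) := by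
      intro d
      rw [mul_inv, Real.rpow_neg (hmd0 d V), Real.rpow_natCast]
      refine mul_le_mul_of_nonneg_left ?_ (inv_nonneg.2 hc₀.le)
      exact inv_anti₀ (pow_pos (hmdV d) k) (pow_le_pow_left₀ (hmd0 d V) (hmd_le d V) k)
    have hreal : tx V ≤ A₀ + c₀⁻¹ * ∑ d, md d V ^ (-(k : ℝ)) * Rd d V := by
      refine (hpt V hbV).trans (add_le_add le_rfl ?_)
      rw [Finset.mul_sum, Finset.mul_sum]
      refine Finset.sum_le_sum fun d _ => ?_
      calc (c₀ * b V ^ k)⁻¹ * ∑ j : n, (if |(hHerm V).eigenvalues j| ≤ 1 then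
            |J d V ⇑((hHerm V).eigenvectorBasis j)| * φ ((hHerm V).eigenvalues j) else 0)
          ≤ (c₀⁻¹ * md d V ^ (-(k : ℝ))) * Rd d V :=
            mul_le_mul (hw d) (hcut d) (Finset.sum_nonneg fun j _ => by
              split_ifs
              · exact mul_nonneg (abs_nonneg _) (hφ0 _)
              · exact le_rfl) (mul_nonneg (inv_nonneg.2 hc₀.le) (Real.rpow_nonneg (hmd0 d V) _))
        _ = c₀⁻¹ * (md d V ^ (-(k : ℝ)) * Rd d V) := by ring
    -- pass to `ℝ≥0∞`
    have hsum0 : 0 ≤ ∑ d, md d V ^ (-(k : ℝ)) * Rd d V :=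
      Finset.sum_nonneg fun d _ => mul_nonneg (Real.rpow_nonneg (hmd0 d V) _) (hRd0 d V)
    calc ENNReal.ofReal (tx V) ≤ ENNReal.ofReal (A₀ + c₀⁻¹ * ∑ d, md d V ^ (-(k : ℝ)) * Rd d V) :=
          ENNReal.ofReal_le_ofReal hreal
      _ = ENNReal.ofReal A₀ + ENNReal.ofReal c₀⁻¹ * ∑ d, Md d V * ENNReal.ofReal (Rd d V) := by
          rw [ENNReal.ofReal_add hA₀ (mul_nonneg (inv_nonneg.2 hc₀.le) hsum0),
            ENNReal.ofReal_mul (inv_nonneg.2 hc₀.le), ENNReal.ofReal_sum_of_nonneg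
              (fun d _ => mul_nonneg (Real.rpow_nonneg (hmd0 d V) _) (hRd0 d V))]
          congr 2
          refine Finset.sum_congr rfl fun d _ => ?_
          rw [ENNReal.ofReal_mul (Real.rpow_nonneg (hmd0 d V) _)]
  -- circle bounds for the majorants
  have hcircle : ∀ d (V : ι → G), ∫⁻ t in Set.Ioc 0 (2 * Real.pi),
      ENNReal.ofReal (Rd d (Function.update V (e d) (V (e d) * c d t))) ≤ B := by
    intro d V
    exact (coareaWegner_majorant_circle_lintegral (e d) Hof hHerm (hmul d) (hcont d) hHof φ hφ hφ0 V).trans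
      (harea d V)
  -- integrate
  have hdir : ∀ d, ∫⁻ V, Md d V * ENNReal.ofReal (Rd d V) ∂μ ≤
      ENNReal.ofReal (2 * Real.pi)⁻¹ * B * ENNReal.ofReal (1 + C_B * (k / (m - k))) := by
    intro d
    refine (coareaWegner_lintegral_mul_le_of_circle_bound (e d) (hcont d).measurable (hMd_meas d)
      (hRd_meas d) (hMd_fib d) (hcircle d)).trans ?_
    exact mul_le_mul' le_rfl (hMd_int d)
  calc ∫⁻ V, ENNReal.ofReal (tx V) ∂μ
      ≤ ∫⁻ V, (ENNReal.ofReal A₀ + ENNReal.ofReal c₀⁻¹ * ∑ d, Md d V * ENNReal.ofReal (Rd d V)) ∂μ :=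
        lintegral_mono_ae hptae
    _ = ENNReal.ofReal A₀ + ENNReal.ofReal c₀⁻¹ * ∑ d, ∫⁻ V, Md d V * ENNReal.ofReal (Rd d V) ∂μ := by
        have hprod : ∀ d, Measurable fun V : ι → G => Md d V * ENNReal.ofReal (Rd d V) := fun d =>
          Measurable.mul (hMd_meas d) (hRd_meas d)
        have hsum : Measurable fun V : ι → G => ∑ d, Md d V * ENNReal.ofReal (Rd d V) :=
          Finset.measurable_sum _ fun d _ => hprod d
        rw [lintegral_add_left measurable_const, lintegral_const, measure_univ, mul_one,
          lintegral_const_mul _ hsum, lintegral_finsetSum _ fun d _ => hprod d]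
    _ ≤ ENNReal.ofReal A₀ + ENNReal.ofReal c₀⁻¹ * ∑ _d : Dir,
          (ENNReal.ofReal (2 * Real.pi)⁻¹ * B * ENNReal.ofReal (1 + C_B * (k / (m - k)))) := by
        gcongr with d _
        exact hdir d
    _ = _ := by
        rw [Finset.sum_const, Finset.card_univ, nsmul_eq_mul]

end Core

/-- **The abstract core of the 1-D route** (explicit-binder form of `coareaWegner_core_lintegral_le`, the
statement registered for this bridge): pointwise rigidity bound + circle majorants + slice + tube sum give
`∫⁻ t dμ ≤ A₀ + c₀⁻¹ · #directions · (2π)⁻¹ · B · (1 + C_B k/(m − k))`. -/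
theorem coareaWegner_coreBound {G : Type*} [Group G] [TopologicalSpace G] [IsTopologicalGroup G]
    [CompactSpace G] [MeasurableSpace G] [BorelSpace G] [SecondCountableTopology G] {ι : Type*} [Fintype ι]
    [DecidableEq ι] {n : Type*} [Fintype n] [DecidableEq n]
    (Hof : (ι → G) → Matrix n n ℂ) (hHof : Continuous Hof) (hHerm : ∀ V, (Hof V).IsHermitian)
    (tx : (ι → G) → ℝ)
    (b : (ι → G) → ℝ) (hbc : Continuous b) (hb0 : ∀ V, 0 ≤ b V)
    (φ : ℝ → ℝ) (hφ : Continuous φ) (hφ0 : ∀ E, 0 ≤ φ E)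
    {A₀ c₀ C_B m : ℝ} {k : ℕ} (hA₀ : 0 ≤ A₀) (hc₀ : 0 < c₀) (hCB : 0 < C_B) (hkm : (k : ℝ) < m)
    (e₀ : ι)
    (hsmall : ∀ (e' : ι) (δ : ℝ), 0 < δ → δ ≤ 1 →
      (Measure.pi fun _ : ι => haarProbability G) {V : ι → G | ∃ g : G, b (Function.update V e' g) < δ} ≤
        ENNReal.ofReal (C_B * δ ^ m))
    {Dir : Type*} [Fintype Dir] (e : Dir → ι) (c : Dir → ℝ → G) (hc0 : ∀ d, c d 0 = 1)
    (hmul : ∀ d s t, c d (s + t) = c d s * c d t) (hcont : ∀ d, Continuous (c d))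
    (J : Dir → (ι → G) → (n → ℂ) → ℝ)
    (hJ : ∀ d (V : ι → G) (ψ : n → ℂ),
      HasDerivAt (fun s => (star ψ ⬝ᵥ (Hof (Function.update V (e d) (V (e d) * c d s))).mulVec ψ).re)
        (J d V ψ) 0)
    (hlip : ∀ d (V : ι → G), ∃ K : NNReal, ∀ i : Fin (Fintype.card n),
      LipschitzWith K fun s => (hHerm (Function.update V (e d) (V (e d) * c d s))).eigenvalues₀ i)
    (hdiffH : ∀ d (V : ι → G), ∃ Hd : Matrix n n ℂ, ∀ p q,
      HasDerivAt (fun s => Hof (Function.update V (e d) (V (e d) * c d s)) p q) (Hd p q) 0)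
    {B : ENNReal}
    (harea : ∀ d (V : ι → G), ∑ i : Fin (Fintype.card n), ∫⁻ t in Set.Icc 0 (2 * Real.pi),
      ENNReal.ofReal (|deriv (fun s => (hHerm (Function.update V (e d) (V (e d) * c d s))).eigenvalues₀ i) t| *
        φ ((hHerm (Function.update V (e d) (V (e d) * c d t))).eigenvalues₀ i)) ≤ B)
    (hpt : ∀ V : ι → G, 0 < b V → tx V ≤ A₀ + (c₀ * b V ^ k)⁻¹ *
      ∑ d, ∑ j : n, (if |(hHerm V).eigenvalues j| ≤ 1 then
        |J d V ⇑((hHerm V).eigenvectorBasis j)| * φ ((hHerm V).eigenvalues j) else 0)) :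
    ∫⁻ V, ENNReal.ofReal (tx V) ∂(Measure.pi fun _ : ι => haarProbability G) ≤
      ENNReal.ofReal A₀ + ENNReal.ofReal c₀⁻¹ * (Fintype.card Dir *
        (ENNReal.ofReal (2 * Real.pi)⁻¹ * B * ENNReal.ofReal (1 + C_B * (k / (m - k))))) :=
  coareaWegner_core_lintegral_le Hof hHof hHerm tx b hbc hb0 φ hφ hφ0 hA₀ hc₀ hCB hkm e₀ hsmall e c hc0 hmul
    hcont J hJ hlip hdiffH harea hpt

end Summit.QuantumFields.QCD.Cruxes.WegnerEstimate.ResolventCell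

end
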